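import Mathlib
import HarnessLib
import Summits.HubbardSuperconductivity.HubbardSuperconductivity.Theorems.KLProgrammeKLRegimeSplitTwoLegReductions
import Summits.HubbardSuperconductivity.HubbardSuperconductivity.Theorems.KLProgrammeKLRegimeSplitFermiPointC4Regime
import Summits.HubbardSuperconductivity.HubbardSuperconductivity.Theorems.KLProgrammeKLRegimeSplitSymInterp
import Summits.HubbardSuperconductivity.HubbardSuperconductivity.Theorems.KLProgrammeKLRegimeSplitEvalDerivBounds

/-!
# Route `KLProgramme` — ENGINE child `KLRegimeEngineV11` (stmt-HubbardSuperconductivity-19823), two-leg stubs: (E3g) `TwoLegAngularG`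
# FROM ONE ANALYTIC INPUT — position-space MOMENTS of the scale-`n` two-leg data — plus `FrameOK` (cell gate-hubbard-kl, seat p1b g5)

Assembly of the (E3g) reduction chain: `twoLegAngularG_of_curve_bounds` (`…SplitTwoLegReductions`) needs (i) momentum regularity of the
two-leg interpolant `D_n(K) = klTwoLegPoly … K n = symInterp L (klLocSelfEnergyRe … K n)` and (ii) `C⁴` bounds of the Fermi-point map.
(ii) is `fermiPointLp_C4_of_frameOK` (`…SplitFermiPointC4Regime`, every admissible frame in the regime, frame/volume-free constant).
(i) is p1b g4's toolkit: `‖Dʲ evalM (symInterp L F)‖ ≤ coeffNorm j ≤ Σ_x (1 + |x̃₀| + |x̃₁|)ʲ·|F_c(x)|` (`norm_iteratedFDeriv_evalM_le_coeffNorm`,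
`coeffNorm_symInterp_le`), `F_c = torusCosCoeff L F` the lattice cosine coefficients of the two-leg data = the position-space two-leg kernel.
Hence **(E3g) at scale `n` for an admissible frame in the regime follows from a bound `m` on the moments of orders `≤ 4` of the scale-`n`
two-leg coefficients and the fit `j!·m·Dʲ ≤ angBar G Q R U (nScales β) j`** (`twoLegAngularG_of_moments`), `D` the curve constant.
Proofs only; nothing is asserted about the Hubbard model (the moment bound is the hypothesis the scale-`n` expansion must deliver).
-/

noncomputable section

namespace Summit.HubbardSuperconductivity.HubbardSuperconductivity.Theorems.KLRegimeSplit

set_option linter.dupNamespace false -- summit = problem name (single-conjunct summit), D-0017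

open Real Finset
open Literature.MathematicalPhysics.QuantumLattice Literature.Probability.LatticeModels
open Literature.MathematicalPhysics.QuantumLattice.FermiRG
open Summit.HubbardSuperconductivity.HubbardSuperconductivity.Theorems.KLProgrammeLegKernels
open Summit.HubbardSuperconductivity.HubbardSuperconductivity.Theorems.DispersionFlow
open Summit.HubbardSuperconductivity.HubbardSuperconductivity.Theorems.PerturbedFermiCurve

section Model

variable {L M : ℕ} [NeZero L] [NeZero M]

/-- **Momentum regularity of the two-leg interpolant from coefficient moments**: if the lattice cosine coefficients of the scale-`n`
two-leg data have `j`-th moment `≤ m`, then `‖Dʲ evalM (D_n(K))‖ ≤ m`. -/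
theorem norm_iteratedFDeriv_evalM_klTwoLegPoly_le_of_moments {β U μ : ℝ} {K : TrigPolyC4v} {n j : ℕ} {m : ℝ}
    (hm : ∑ x : TorusSite 2 L, (1 + (x 0).valMinAbs.natAbs + (x 1).valMinAbs.natAbs : ℝ) ^ j *
      |torusCosCoeff L (klLocSelfEnergyRe L M β U μ K n) x| ≤ m) (q : Momentum) :
    ‖iteratedFDeriv ℝ j (evalM (klTwoLegPoly L M β U μ K n)) q‖ ≤ m :=
  (norm_iteratedFDeriv_evalM_le_coeffNorm _ j q).trans ((coeffNorm_symInterp_le _ j).trans hm)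

/-- **(E3g) FROM MOMENTS AND THE CURVE**: moments of orders `≤ 4` of the scale-`n` two-leg coefficients bounded by `m`, the Fermi-point map
`C⁴` with `‖Dⁱγ‖ ≤ Dⁱ` (`1 ≤ i ≤ 4`), and the fit `j!·m·Dʲ ≤ angBar … j` (`1 ≤ j ≤ 4`) give `TwoLegAngularG … K n`. -/
theorem twoLegAngularG_of_moments_and_curve {G : GeoConsts} {Q : EngConsts} {R : RenConsts} {β U μ : ℝ} {K : TrigPolyC4v} {n : ℕ}
    {m D : ℝ}
    (hm : ∀ j ≤ 4, ∑ x : TorusSite 2 L, (1 + (x 0).valMinAbs.natAbs + (x 1).valMinAbs.natAbs : ℝ) ^ j *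
      |torusCosCoeff L (klLocSelfEnergyRe L M β U μ K n) x| ≤ m)
    (hγ : ContDiff ℝ 4 fun θ => (WithLp.toLp 2 (klFermiPoint μ K θ) : Momentum))
    (hD : ∀ i, 1 ≤ i → i ≤ 4 → ∀ θ : ℝ,
      ‖iteratedDeriv i (fun θ => (WithLp.toLp 2 (klFermiPoint μ K θ) : Momentum)) θ‖ ≤ D ^ i)
    (hfit : ∀ j, 1 ≤ j → j ≤ 4 → (j.factorial : ℝ) * m * D ^ j ≤ angBar G Q R U (nScales β) j) :
    TwoLegAngularG L M G Q R β U μ K n :=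
  twoLegAngularG_of_curve_bounds (fun i hi q => norm_iteratedFDeriv_evalM_klTwoLegPoly_le_of_moments (hm i hi) q) hγ hD hfit

end Model

/-- **(E3g) FOR EVERY ADMISSIBLE FRAME IN THE KL REGIME, FROM THE TWO-LEG MOMENTS ALONE.**  For every `R` (`Gfr ≥ 0`) there are
`c₃, U₀ > 0` and, for `0 < c ≤ c₃`, `0 < U ≤ U₀`, `klBetaMin ≤ β ≤ e^{c/U²}`, a curve constant `D ≥ 1` (frame- and volume-free) such that:
whenever the scale-`n` two-leg coefficient moments of orders `≤ 4` of an admissible frame `K` (`FrameOK R U (nScales β) μ K`, `μ ∈ klWindowC`)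
are `≤ m` and `j!·m·Dʲ ≤ angBar G Q R U (nScales β) j` (`1 ≤ j ≤ 4`), then `TwoLegAngularG L M G Q R β U μ K n`. -/
theorem twoLegAngularG_of_moments (R : RenConsts) (hR : ∀ j, 0 ≤ R.Gfr j) :
    ∃ c₃ : ℝ, 0 < c₃ ∧ ∃ U₀ : ℝ, 0 < U₀ ∧
      ∀ c : ℝ, 0 < c → c ≤ c₃ → ∀ U : ℝ, 0 < U → U ≤ U₀ → ∀ β : ℝ, klBetaMin ≤ β → β ≤ Real.exp (c / U ^ 2) →
      ∃ D : ℝ, 1 ≤ D ∧ ∀ μ ∈ klWindowC, ∀ K : TrigPolyC4v, FrameOK R U (nScales β) μ K →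
        ∀ (L M : ℕ) [NeZero L] [NeZero M] (G : GeoConsts) (Q : EngConsts) (n : ℕ) (m : ℝ),
          (∀ j ≤ 4, ∑ x : TorusSite 2 L, (1 + (x 0).valMinAbs.natAbs + (x 1).valMinAbs.natAbs : ℝ) ^ j *
            |torusCosCoeff L (klLocSelfEnergyRe L M β U μ K n) x| ≤ m) →
          (∀ j, 1 ≤ j → j ≤ 4 → (j.factorial : ℝ) * m * D ^ j ≤ angBar G Q R U (nScales β) j) →
          TwoLegAngularG L M G Q R β U μ K n := by
  obtain ⟨c₃, hc₃, U₀, hU₀, h⟩ := fermiPointLp_C4_of_frameOK R hR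
  refine ⟨c₃, hc₃, U₀, hU₀, fun c hc hcle U hU hUle β hβ hβc => ?_⟩
  obtain ⟨D, hD1, hD⟩ := h c hc hcle U hU hUle β hβ hβc
  refine ⟨D, hD1, fun μ hμ K hK L M _ _ G Q n m hm hfit => ?_⟩
  obtain ⟨hγ, hDer⟩ := hD μ hμ K hK
  exact twoLegAngularG_of_moments_and_curve hm hγ hDer hfit

end Summit.HubbardSuperconductivity.HubbardSuperconductivity.Theorems.KLRegimeSplit

end
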